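import Literature.AlgebraicGeometry.Frobenioids.ArithmeticFrobenioidsProofs
import Mathlib.NumberTheory.Real.Irrational
import HarnessLib

/-!
# Frobenioids I, Theorem 6.4 (ii)–(iv): the universal closures of the typed SCHEMATA `Thm64iiDeg`,
# `Thm64ii`, `Thm64iii`, `Thm64iv` are refutable — PROOF-ONLY (kernel `¬ ∀`)

Mochizuki, *The geometry of Frobenioids I: the general theory*, Kyushu J. Math. **62** (2008) 293–400,
Theorem 6.4 (ii) p. 114, (iii) pp. 114–115, (iv) p. 115 [cite: MochizukiFrdI2008, Thm. 6.4 (ii) p.114]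
[cite: MochizukiFrdI2008, Thm. 6.4 (iii) p.114] [cite: MochizukiFrdI2008, Thm. 6.4 (iv) p.115].

PROOF-ONLY companion of `ArithmeticFrobenioids.lean` (cell abc-iut, F fact-proving wave, seat abc-iut-f-016;
FROZEN FACT-LIST rows F-0889 `Thm64ii`, F-0890 `Thm64iiDeg`, F-0891 `Thm64iii`, F-0892 `Thm64iv`; no `def`,
no `instance`, no `structure`: every witness is built inside a proof).  The four declarations of abc-iut-L1-t3
are SCHEMATA over the data-only interface `ArithRealification R₁ R₂` (any `Pic`, any `δ_A : Pic_Φ(A) ≃ ℝ`) and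
FREE binders `picMap`, `deg`, `placeMap`, `Ψ^Base`; their own docstrings say so («as a closed statement over a
free `picMap` it is false (replace `picMap` by `-picMap`)»; «faithful only for THE realifications … not a closed
citable fact»).  This file makes that remark a KERNEL event (plan rule R5: the universal closure of a schema row
is not a fact): for each of the four, `theorem not_forall_<Decl> : ¬ ∀ (all binders), <Decl> …`.

The countermodel (`exists_thm64_countermodel`, universe-polymorphic): over `F = K = ℚ`, the one-object category
`T` with `End(⋆) = ℕ_{≥1}` (composition = multiplication), made into `PreFrobenioidData` over `D = B(Gal(ℚ/ℚ))⁰`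
by `Base ≡ Spec ℚ`, `Φ =` THE effective arithmetic divisors with THE pull-backs (`arithDivisorMonoidOn ℚ ℚ`),
`Div ≡ 0`, `deg_Fr = id`; so `⋆` is Frobenius-trivial (`ζ = id : ℕ_{≥1} → End(⋆)`), and with `Pic_Φ ≡ ℝ`,
`δ ≡ id` every real `c ≠ 0` gives an additive automorphism `picMap = (c · )` with `δ ∘ picMap = c · δ`.  Hence:
`Thm64iiDeg` fails at `deg = 0`; `Thm64ii` fails for `picMap = (-1 · )`; `Thm64iii` (whose hypothesis
`Thm64iiDeg … deg` then HOLDS with `deg = √2`, and whose `1`-commutation hypothesis holds for identity functors)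
concludes `deg ∈ ℚ` — false; `Thm64iv` (hypotheses hold with `deg = 2`, identity functors, and `Ψ^Base = 𝟭`,
the `1`-uniqueness being automatic because `B(Gal(ℚ/ℚ))⁰` is a contractible category:
`FinSubextCat.nonempty_iso_of_rat`) concludes `deg = 1` — false.

What this does NOT say: nothing here contradicts [FrdI] Thm. 6.4 — print's (ii)–(iv) are about THE
realifications `C_i^rlf`, THE groups `Pic_Φ`, THE degree maps `δ_A` and THE maps induced by the equivalences,
for which the instance forms are the business of the L1 sub-DAG crews (`Thm64ii_of_monotone`,
`ArithmeticFrobenioidThm64iii*.lean`, `ArithmeticFrobenioidThm64ivSchema.lean`, THE instance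
`arithRealification`); the refutations only certify that the four rows cannot be consumed as closed facts.
Classical, undisputed mathematics; nothing here bears on [IUTchIII] Cor. 3.12 or asserts anything about abc;
typed ≠ proved; no side taken.
-/

noncomputable section

namespace Literature.AlgebraicGeometry.Frobenioids

open CategoryTheory

universe u v

/-! ### The base category `B(Gal(ℚ/ℚ))⁰ = FinSubextCat ℚ ℚ` is contractible -/

/-- Over `F = K = ℚ` every hom-set of `D = FinSubextCat ℚ ℚ` has at most one element: an `ℚ`-algebra map
between subfields of `ℚ` is determined on `ℚ`. [cite: MochizukiFrdI2008, Ex. 6.3 p.113] -/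
theorem FinSubextCat.hom_eq_of_rat (X Y : FinSubextCat ℚ ℚ) (f g : X ⟶ Y) : f = g := by
  refine FinSubextCat.hom_ext (AlgHom.ext fun y => ?_)
  have hy : y = ((y : ℚ) : Y.L) := Subtype.ext (by simp)
  rw [hy, map_ratCast, map_ratCast]

/-- Over `F = K = ℚ` every hom-set of `D = FinSubextCat ℚ ℚ` is inhabited (`M ⊆ ℚ → ℚ ⊆ L`).
[cite: MochizukiFrdI2008, Ex. 6.3 p.113] -/
theorem FinSubextCat.nonempty_hom_of_rat (X Y : FinSubextCat ℚ ℚ) : Nonempty (X ⟶ Y) :=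
  ⟨⟨(Algebra.ofId ℚ X.L).comp Y.L.val⟩⟩

/-- Hence any two functors into `FinSubextCat ℚ ℚ` are isomorphic (the category is contractible); in
particular every `1`-commutation / `1`-uniqueness clause valued in `B(Gal(ℚ/ℚ))⁰` holds.
[cite: MochizukiFrdI2008, Ex. 6.3 p.113] -/
theorem FinSubextCat.nonempty_iso_of_rat {J : Type*} [Category J] (G G' : J ⥤ FinSubextCat ℚ ℚ) :
    Nonempty (G ≅ G') :=
  ⟨NatIso.ofComponents
    (fun _ => ⟨(FinSubextCat.nonempty_hom_of_rat _ _).some, (FinSubextCat.nonempty_hom_of_rat _ _).some,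
      FinSubextCat.hom_eq_of_rat _ _ _ _, FinSubextCat.hom_eq_of_rat _ _ _ _⟩)
    (fun _ => FinSubextCat.hom_eq_of_rat _ _ _ _)⟩

/-! ### The one-object countermodel -/

/-- **Countermodel for the schemata of Thm. 6.4 (ii)–(iv)** (universe-polymorphic, built inside the proof):
over `F = K = ℚ` there are a category `T` (one object `⋆`, `End(⋆) = ℕ_{≥1}`), an `ArithRealification R` on `T`
(`Base ≡ Spec ℚ`, `Φ =` effective arithmetic divisors with THE pull-backs, `Div ≡ 0`, `deg_Fr = id`,
`Pic_Φ ≡ ℝ`, `δ ≡ id`), an `ArithModelFrobenioid ℚ ℚ T` with the same operations, and a Frobenius-trivial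
object `A = ⋆`, such that for every real `c ≠ 0` some family of additive automorphisms `s_B : Pic(B) ≃ Pic(B)`
satisfies `δ_B (s_B x) = c · δ_B x`. [cite: MochizukiFrdI2008, Thm. 6.4 (ii) p.114] -/
theorem exists_thm64_countermodel.{u₁, v₁} :
    ∃ (T : Type u₁) (_ : Category.{v₁} T) (R : ArithRealification (F := ℚ) (K := ℚ) T)
      (_ : ArithModelFrobenioid ℚ ℚ T) (A : T) (_ : R.ops.IsFrobeniusTrivial A),
      ∀ c : ℝ, c ≠ 0 → ∃ s : ∀ B : T, R.Pic B ≃+ R.Pic B,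
        ∀ (B : T) (hB : R.ops.IsFrobeniusTrivial B) (x : R.Pic B), R.δ B hB (s B x) = c * R.δ B hB x := by
  letI instT : Category.{v₁} PUnit.{u₁ + 1} :=
    { Hom := fun _ _ => ULift.{v₁} ℕ+
      id := fun _ => 1
      comp := fun f g => f * g
      id_comp := fun f => one_mul f
      comp_id := fun f => mul_one f
      assoc := fun f g h => mul_assoc f g h }
  let X₀ : FinSubextCat ℚ ℚ := ⟨⊥⟩
  let S : PreFrobenioidData.{0} PUnit.{u₁ + 1} (FinSubextCat ℚ ℚ) :=
    { base := (Functor.const _).obj X₀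
      Mon := fun X => Multiplicative (EffArithDivisor X.L)
      pull := fun σ => (arithDivisorMonoidOn ℚ ℚ).pull σ
      pull_id := fun X x => (arithDivisorMonoidOn ℚ ℚ).pull_id X x
      pull_comp := fun β α x => (arithDivisorMonoidOn ℚ ℚ).pull_comp β α x
      div := fun _ => 1
      degFr := fun φ => ULift.down φ
      div_id := fun _ => rfl
      div_comp := fun ψ φ => by simp
      degFr_id := fun _ => rfl
      degFr_comp := fun _ _ => rfl }
  refine ⟨PUnit.{u₁ + 1}, instT, { ops := S, Pic := fun _ => ℝ, δ := fun _ _ => AddEquiv.refl ℝ },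
    { ops := S, monEquiv := fun _ => MulEquiv.refl _ }, PUnit.unit, ?_, fun c hc => ?_⟩
  · -- `⋆` is Frobenius-trivial: `ζ = id : ℕ_{≥1} → End(⋆)`
    refine ⟨
      { toFun := fun n => ULift.up n
        map_one' := rfl
        map_mul' := fun m n => congrArg ULift.up (mul_comm m n) },
      fun n => ⟨rfl, rfl, ⟨?_, rfl⟩, ?_⟩⟩
    · -- co-angular: an isometric pre-step is linear, i.e. of Frobenius degree `1`, i.e. the identity
      intro X Y γ β α _ _ hβ _
      have hβ1 : β = 𝟙 Y := ULift.ext β (𝟙 Y) hβ.1.1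
      subst hβ1
      infer_instance
    · -- base-isomorphism: `Base(ζ n) = id_{Spec ℚ}`
      exact (inferInstance : IsIso (𝟙 X₀))
  · refine ⟨fun _ =>
        { toFun := fun x => c * x
          invFun := fun x => c⁻¹ * x
          left_inv := fun x => inv_mul_cancel_left₀ hc x
          right_inv := fun x => mul_inv_cancel_left₀ hc x
          map_add' := fun x y => mul_add c x y },
      fun B hB x => rfl⟩

/-! ### The four universal closures refuted -/

/-- **F-0890 / `Thm64iiDeg` ([FrdI] Thm. 6.4 (ii) p. 114, the degree relation) — universal closure REFUTED**:
the schema quantifies over a FREE real `deg`; at `deg = 0` its first conjunct `0 < deg` fails (any data, e.g. the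
countermodel). The row is consumable only at THE degree of THE `Ψ^rlf` (instance forms), never as a closed fact.
[cite: MochizukiFrdI2008, Thm. 6.4 (ii) p.114] -/
theorem not_forall_Thm64iiDeg :
    ¬ ∀ (F₁ : Type) [Field F₁] (K₁ : Type) [Field K₁] [Algebra F₁ K₁]
        (F₂ : Type) [Field F₂] (K₂ : Type) [Field K₂] [Algebra F₂ K₂]
        (Rlf₁ : Type u) [Category.{v} Rlf₁] (Rlf₂ : Type u) [Category.{v} Rlf₂]
        (R₁ : ArithRealification (F := F₁) (K := K₁) Rlf₁) (R₂ : ArithRealification (F := F₂) (K := K₂) Rlf₂)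
        (Ψ : Rlf₁ ≌ Rlf₂) (picMap : ∀ A : Rlf₁, R₁.Pic A ≃+ R₂.Pic (Ψ.functor.obj A)) (deg : ℝ),
        Literature.AlgebraicGeometry.Frobenioids.Thm64iiDeg R₁ R₂ Ψ picMap deg := by
  intro h
  obtain ⟨T, _, R, -, A, -, hs⟩ := exists_thm64_countermodel.{u, v}
  obtain ⟨s, -⟩ := hs 1 one_ne_zero
  exact lt_irrefl (0 : ℝ) (h ℚ ℚ ℚ ℚ T T R R (CategoryTheory.Equivalence.refl (C := T)) s 0).1

/-- **F-0889 / `Thm64ii` ([FrdI] Thm. 6.4 (ii) p. 114, existence of `deg(Ψ^rlf) ∈ ℝ_{>0}`) — universal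
closure REFUTED** (the trunk docstring's own remark, now in kernel): in the countermodel take `Ψ^rlf = id` and
the FREE `picMap := (-1 · )` on `Pic_Φ ≡ ℝ`; at the Frobenius-trivial object `⋆` and `x = δ⁻¹(1)` a degree
`deg > 0` would satisfy `-1 = deg`. [cite: MochizukiFrdI2008, Thm. 6.4 (ii) p.114] -/
theorem not_forall_Thm64ii :
    ¬ ∀ (F₁ : Type) [Field F₁] (K₁ : Type) [Field K₁] [Algebra F₁ K₁]
        (F₂ : Type) [Field F₂] (K₂ : Type) [Field K₂] [Algebra F₂ K₂]
        (Rlf₁ : Type u) [Category.{v} Rlf₁] (Rlf₂ : Type u) [Category.{v} Rlf₂]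
        (R₁ : ArithRealification (F := F₁) (K := K₁) Rlf₁) (R₂ : ArithRealification (F := F₂) (K := K₂) Rlf₂)
        (Ψ : Rlf₁ ≌ Rlf₂) (picMap : ∀ A : Rlf₁, R₁.Pic A ≃+ R₂.Pic (Ψ.functor.obj A)),
        Literature.AlgebraicGeometry.Frobenioids.Thm64ii R₁ R₂ Ψ picMap := by
  intro h
  obtain ⟨T, _, R, -, A, hA, hs⟩ := exists_thm64_countermodel.{u, v}
  obtain ⟨s, hs⟩ := hs (-1) (by norm_num)
  obtain ⟨deg, hdeg, hall⟩ := h ℚ ℚ ℚ ℚ T T R R (CategoryTheory.Equivalence.refl (C := T)) s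
  have h1 : R.δ A hA (s A ((R.δ A hA).symm 1)) = deg * R.δ A hA ((R.δ A hA).symm 1) := hall A hA hA _
  rw [hs, AddEquiv.apply_symm_apply] at h1
  linarith

/-- **F-0891 / `Thm64iii` ([FrdI] Thm. 6.4 (iii) pp. 114–115, `deg(Ψ^rlf) ∈ ℚ_{>0}` and the place
compatibilities) — universal closure REFUTED**: in the countermodel with `Ψ^rlf = Ψ' = id`, `u_i = id` and the
FREE `picMap := (√2 · )`, the schema's hypotheses HOLD (`Thm64iiDeg … √2`: `δ ∘ picMap = √2 · δ`; the square
`1`-commutes) while its conclusion `deg ∈ ℚ` fails (`√2 ∉ ℚ`). The row is faithful only for THE `picMap` induced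
by an equivalence of THE categories `(C_i^pf)^un-tr` (instance forms, `ArithmeticFrobenioidThm64iii*.lean`).
[cite: MochizukiFrdI2008, Thm. 6.4 (iii) p.114] -/
theorem not_forall_Thm64iii :
    ¬ ∀ (F₁ : Type) [Field F₁] [NumberField F₁] (K₁ : Type) [Field K₁] [Algebra F₁ K₁]
        (F₂ : Type) [Field F₂] [NumberField F₂] (K₂ : Type) [Field K₂] [Algebra F₂ K₂]
        (Rlf₁ : Type u) [Category.{v} Rlf₁] (Rlf₂ : Type u) [Category.{v} Rlf₂]
        (R₁ : ArithRealification (F := F₁) (K := K₁) Rlf₁) (R₂ : ArithRealification (F := F₂) (K := K₂) Rlf₂)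
        (Ψ : Rlf₁ ≌ Rlf₂) (picMap : ∀ A : Rlf₁, R₁.Pic A ≃+ R₂.Pic (Ψ.functor.obj A)) (deg : ℝ)
        (U₁ : Type u) [Category.{v} U₁] (U₂ : Type u) [Category.{v} U₂] (u₁ : U₁ ⥤ Rlf₁) (u₂ : U₂ ⥤ Rlf₂)
        (Ψ' : U₁ ≌ U₂) (A₁ : U₁)
        (placeMap : Places (R₁.ops.base.obj (u₁.obj A₁)).L ≃
          Places (R₂.ops.base.obj (u₂.obj (Ψ'.functor.obj A₁))).L),
        Literature.AlgebraicGeometry.Frobenioids.Thm64iii R₁ R₂ Ψ picMap deg u₁ u₂ Ψ' A₁ placeMap := by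
  intro h
  obtain ⟨T, _, R, -, A, -, hs⟩ := exists_thm64_countermodel.{u, v}
  obtain ⟨s, hs⟩ := hs (Real.sqrt 2) (by positivity)
  have hdeg : Thm64iiDeg R R (CategoryTheory.Equivalence.refl (C := T)) s (Real.sqrt 2) :=
    ⟨by positivity, fun B _ hB' x => hs B hB' x⟩
  have hcomm : OneCommutes (CategoryTheory.Equivalence.refl (C := T)).functor (𝟭 T) (𝟭 T)
      (CategoryTheory.Equivalence.refl (C := T)).functor := ⟨Iso.refl _⟩
  obtain ⟨⟨q, -, hq⟩, -⟩ := h ℚ ℚ ℚ ℚ T T R R (CategoryTheory.Equivalence.refl (C := T)) s (Real.sqrt 2) T T (𝟭 T) (𝟭 T)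
    (CategoryTheory.Equivalence.refl (C := T)) A (Equiv.refl _) hdeg hcomm
  exact irrational_sqrt_two ⟨q, hq.symm⟩

/-- **F-0892 / `Thm64iv` ([FrdI] Thm. 6.4 (iv) p. 115, `deg(Ψ^rlf) = 1` and the field isomorphism) —
universal closure REFUTED**: in the countermodel with `C_i = C_i^rlf = T`, `Ψ = Ψ^rlf = id`, realification
functors `r_i = id`, `Ψ^Base = 𝟭`, and the FREE `picMap := (2 · )`, the schema's three hypotheses HOLD
(`Thm64iiDeg … 2`; the square `1`-commutes; `Ψ^Base = 𝟭` is `1`-unique because `B(Gal(ℚ/ℚ))⁰` is contractible)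
while its conclusion `deg = 1` fails. The row is faithful only for THE realification functors and THE induced
`picMap` (instance forms, `ArithmeticFrobenioidThm64ivSchema.lean`). [cite: MochizukiFrdI2008, Thm. 6.4 (iv) p.115] -/
theorem not_forall_Thm64iv :
    ¬ ∀ (F₁ : Type) [Field F₁] [NumberField F₁] (K₁ : Type) [Field K₁] [Algebra F₁ K₁]
        (F₂ : Type) [Field F₂] [NumberField F₂] (K₂ : Type) [Field K₂] [Algebra F₂ K₂]
        (Rlf₁ : Type u) [Category.{v} Rlf₁] (Rlf₂ : Type u) [Category.{v} Rlf₂]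
        (R₁ : ArithRealification (F := F₁) (K := K₁) Rlf₁) (R₂ : ArithRealification (F := F₂) (K := K₂) Rlf₂)
        (Ψrlf : Rlf₁ ≌ Rlf₂) (picMap : ∀ A : Rlf₁, R₁.Pic A ≃+ R₂.Pic (Ψrlf.functor.obj A)) (deg : ℝ)
        (C₁ : Type u) [Category.{v} C₁] (C₂ : Type u) [Category.{v} C₂]
        (M₁ : ArithModelFrobenioid F₁ K₁ C₁) (M₂ : ArithModelFrobenioid F₂ K₂ C₂)
        (r₁ : C₁ ⥤ Rlf₁) (r₂ : C₂ ⥤ Rlf₂) (Ψ : C₁ ≌ C₂) (ΨBase : FinSubextCat F₁ K₁ ⥤ FinSubextCat F₂ K₂),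
        Literature.AlgebraicGeometry.Frobenioids.Thm64iv R₁ R₂ Ψrlf picMap deg M₁ M₂ r₁ r₂ Ψ ΨBase := by
  intro h
  obtain ⟨T, _, R, M, A, -, hs⟩ := exists_thm64_countermodel.{u, v}
  obtain ⟨s, hs⟩ := hs 2 two_ne_zero
  have hdeg : Thm64iiDeg R R (CategoryTheory.Equivalence.refl (C := T)) s 2 := ⟨two_pos, fun B _ hB' x => hs B hB' x⟩
  have hcomm : OneCommutes (CategoryTheory.Equivalence.refl (C := T)).functor (𝟭 T) (𝟭 T)
      (CategoryTheory.Equivalence.refl (C := T)).functor := ⟨Iso.refl _⟩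
  have hsq : PreFrobenioidData.OneUniqueSquare (CategoryTheory.Equivalence.refl (C := T)).functor M.ops.base M.ops.base
      (𝟭 (FinSubextCat ℚ ℚ)) :=
    ⟨inferInstance, FinSubextCat.nonempty_iso_of_rat _ _, fun B' _ => FinSubextCat.nonempty_iso_of_rat _ _⟩
  obtain ⟨h1, -⟩ := h ℚ ℚ ℚ ℚ T T R R (CategoryTheory.Equivalence.refl (C := T)) s 2 T T M M (𝟭 T) (𝟭 T)
    (CategoryTheory.Equivalence.refl (C := T)) (𝟭 _) hdeg hcomm hsq
  norm_num at h1

end Literature.AlgebraicGeometry.Frobenioids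

end
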